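import Summits.BirchSwinnertonDyer.BirchSwinnertonDyer.Theorems.ResidualThetaTransportAtTwoResidualThetaMainConjectureAtTwoEvalK
import HarnessLib

/-!
# Sketch — stub-ideation `stub_cmLambdaLower` k = 3 (gen 3), technique «decomposition (sub-stubs + provable glue)»,
# home family 3 (probe the extremes)

Crux (R≥)ᵖ `ResidualThetaCountLowerPureAtTwo` (stmt-BirchSwinnertonDyer-26074), skeleton «bt26-lambda» v6, stub S2
`stub_cmLambdaLower : Theses.ResidualThetaTransportAtTwo.ResidualSignedLambdaLowerCMAtTwo` (= item RSL_g, stmt-22608, BY NAME).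
Helper SIGNATURES for the idea card `Ideas/stub-cmlambdalower-k3-g3.md`: the DAG node N2 «ERL⁺@2 for g»
(`RSLG-LINE-DAG-g14.md`) — the only node of S2 whose kernel half is still un-designed (critic STUB-PLAN rev 3 §7 Q11) —
split along the TRACE-FORM SEAM into sub-stubs, with a glue that reads the norm-language `λ`-index `d` off
ABSOLUTE VALUES OF VALUES at ONE primitive character per level (no `Λ`-adic unit, no congruence, no `μ`).

NOTHING here proves S2, the crux, RSL_g or BSD.  Sorried declarations are SIGNATURES for the critic / the stub prover
(helper shapes H1–H5); `normLambda_of_seam` (the glue) is kernel-checked modulo H1.  BSD is NOT proved by any of this.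

* H1  `normLambda_of_norm_eval_radii` / H1′ `normLambda_of_norm_eval_primitiveRoots` — the GLUE ENGINE («dominant term»):
      if `‖F(z)‖ = c·‖G(z')‖` with `‖z‖ = ‖z'‖ → 1⁻` along infinitely many radii (e.g. `z = ζ − 1`, `z' = ζ' − 1`, `ζ, ζ'`
      primitive `pⁿ`-th roots, ONE pair per level, infinitely many levels) and `G` has norm-λ index `d`, then so has `F`
      (any `c > 0`: powers of `ϖ`, `|6|`, period ratios are invisible).  Strictly weaker hypothesis than k1-g2's H4
      (`F ≡ u_n·G mod ω_n`, `u_n ∈ 𝒪⟦T⟧ˣ`), and FALSE-if-weakened exactly where the decorated zeta element fails (card §3).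
* H2  `exists_plusValue_orbitSum_coeff` — `𝒪`-valued plus Coleman VALUE exists (the `⊗𝒪` of the landed
      `SignedColemanImage.exists_plusValue_orbitSum`, by a `ℤ₂`-basis of `𝒪`; needs `𝒪` `2`-adically complete).
* H3  `norm_eval_cyclotomicOmegaMinus_eq` — `‖ω̃⁻_n(ζ−1)‖ = ‖ω̃⁻_n(ζ'−1)‖ ≠ 0` for `ζ, ζ'` primitive of order `2ⁿ`, `n` even.
* H4  `norm_eval_mazurTateElementK_eq_of_isPollackPairK` — `‖θ_n(g)^ι(ζ−1)‖ = ‖ω̃⁻_n(ζ−1)‖·‖L⁻(ζ−1)‖` at even `n`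
      (tree `IsCongrModOmegaO.eval₂_eq_mul` + `IsPollackPairK`, sign `±1` dropped by the norm).
* H5  `norm_eval_eq_of_omega_dvd_sub` — value reading of an exact `ω_n`-congruence in `𝒪⟦T⟧` (`𝒪`-twin, `m = 0`).
* H6  `norm_gaussSum_eq_of_isPrimitive` — `‖τ(χ,ψ)‖ = 2^{−m/2}` for primitive `χ` of conductor `2^m ≥ 4` (convention-free).
* GLUE `normLambda_of_seam` — composes (S1) value reading of the plus Coleman value, (S2) KZ⁺_g-χ ∘ trace form,
      (S3) Honda log Gauss sum, (S4) Birch-K + period ratio, (S5) Pollack, (S6) H3, into H1′.  PROVED from H1′.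
-/

set_option autoImplicit false
set_option linter.dupNamespace false
set_option maxHeartbeats 800000

noncomputable section

open scoped Classical

open PowerSeries Literature.NumberTheory.EllipticCurves Literature.NumberTheory.EllipticCurves.ModularForms

namespace Summit.BirchSwinnertonDyer.BirchSwinnertonDyer.Cruxes.ResidualThetaCountLowerPureAtTwo.StubIdeasK3G3

/-! ### H1. The glue engine: norm-λ from absolute values of values along radii `→ 1⁻` («dominant term») -/

section Engine

variable {p : ℕ} [Fact p.Prime] (S : Set (PadicAlgCl p))

/-- **H1 (signature). Norm-λ is read off `‖F(z)‖` along radii tending to `1`.**  Let `𝒪 = 𝒪_{ℚ_p(S)}` be a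
`p`-ADIC FIELD's valuation ring (`[FiniteDimensional ℚ_[p] (padicCoeffField S)]`: discretely valued — needed, see
the card's falsifier F2), `F, G ∈ 𝒪⟦T⟧`, `G` with norm-λ index `d` (the stub's two LITERAL binders), `c > 0`.
If for radii `r` arbitrarily close to `1` there are `z, z' ∈ ℂ_p` with `‖z‖ = ‖z'‖ = r < 1` and
`‖F(z)‖ = c·‖G(z')‖` (`F(z) = ∑ₖ F_k z^k` in `ℂ_p`), then `F` has norm-λ index `d`.
PROOF ROUTE (no Weierstrass preparation): for `r₀(G) := max_{k<d} ‖G_k/G_d‖^{1/(d−k)} < r < 1` the `d`-th term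
STRICTLY dominates every other term of `∑ G_k z'^k` (`k > d`: `r^k < r^d`; `k < d`: `‖G_k‖ r^k < ‖G_d‖ r^d`), so
`‖G(z')‖ = ‖G_d‖·r^d` (ultrametric equality case); `F ≠ 0` (else `0 = c‖G_d‖r^d`), `F` has SOME norm-λ index `d_F`
(`ResidualThetaLayer.stub_normLambdaWitnessAtTwo`'s argument: discrete value group), hence `‖F(z)‖ = ‖F_{d_F}‖·r^{d_F}` for
`r` near `1`; two distinct radii with `‖F_{d_F}‖ r^{d_F} = c‖G_d‖ r^d` force `d_F = d`.
[cite: Washington1997, §7.2 (values `F(ζ−1)` and the growth `μpⁿ + λn`)] [cite: Lang1990, Ch. 5 §2] -/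
theorem normLambda_of_norm_eval_radii [FiniteDimensional ℚ_[p] (padicCoeffField S)]
    (F G : IwasawaAlgebraO S) (d : ℕ)
    (hle : ∀ k, ‖coeff k (iwasawaOToPowerSeries S G)‖ ≤ ‖coeff d (iwasawaOToPowerSeries S G)‖)
    (hlt : ∀ k < d, ‖coeff k (iwasawaOToPowerSeries S G)‖ < ‖coeff d (iwasawaOToPowerSeries S G)‖)
    {c : ℝ} (hc : 0 < c)
    (h : ∀ r₀ : ℝ, r₀ < 1 → ∃ z z' : ℂ_[p], r₀ < ‖z‖ ∧ ‖z‖ < 1 ∧ ‖z'‖ = ‖z‖ ∧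
      ‖∑' k, algebraMap (PadicAlgCl p) ℂ_[p] (coeff k (iwasawaOToPowerSeries S F)) * z ^ k‖ =
        c * ‖∑' k, algebraMap (PadicAlgCl p) ℂ_[p] (coeff k (iwasawaOToPowerSeries S G)) * z' ^ k‖) :
    (∀ k, ‖coeff k (iwasawaOToPowerSeries S F)‖ ≤ ‖coeff d (iwasawaOToPowerSeries S F)‖) ∧
      ∀ k < d, ‖coeff k (iwasawaOToPowerSeries S F)‖ < ‖coeff d (iwasawaOToPowerSeries S F)‖ := by
  sorry

/-- **H1′ (signature; corollary of H1). One primitive character per level, infinitely many levels, any constant.**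
If for infinitely many `n` there are PRIMITIVE `pⁿ`-th roots of unity `ζ, ζ' ∈ ℂ_p` (not necessarily equal:
`ζ' = ζ⁻¹` absorbs every `χ ↔ χ̄` convention of Kato / Birch) with `‖F(ζ − 1)‖ = c·‖G(ζ' − 1)‖`, and `G` has norm-λ
index `d`, then `F` has norm-λ index `d`.  From H1: `‖ζ − 1‖ = ‖ζ' − 1‖ = p^{−1/((p−1)p^{n−1})} → 1⁻`
(`(ζ^a − 1)/(ζ − 1) ∈ 𝒪_{ℂ_p}` both ways for the first equality; Mathlib `IsPrimitiveRoot.norm_sub_one_two` /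
`norm_pow_sub_one_eq_prime_pow_of_ne_zero` + conjugates for the value).  This is the socket the seam glue below feeds.
[cite: Washington1997, §7.2] -/
theorem normLambda_of_norm_eval_primitiveRoots [FiniteDimensional ℚ_[p] (padicCoeffField S)]
    (F G : IwasawaAlgebraO S) (d : ℕ)
    (hle : ∀ k, ‖coeff k (iwasawaOToPowerSeries S G)‖ ≤ ‖coeff d (iwasawaOToPowerSeries S G)‖)
    (hlt : ∀ k < d, ‖coeff k (iwasawaOToPowerSeries S G)‖ < ‖coeff d (iwasawaOToPowerSeries S G)‖)
    {c : ℝ} (hc : 0 < c)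
    (h : ∀ n₀ : ℕ, ∃ n, n₀ ≤ n ∧ ∃ ζ ζ' : ℂ_[p], IsPrimitiveRoot ζ (p ^ n) ∧ IsPrimitiveRoot ζ' (p ^ n) ∧
      ‖∑' k, algebraMap (PadicAlgCl p) ℂ_[p] (coeff k (iwasawaOToPowerSeries S F)) * (ζ - 1) ^ k‖ =
        c * ‖∑' k, algebraMap (PadicAlgCl p) ℂ_[p] (coeff k (iwasawaOToPowerSeries S G)) * (ζ' - 1) ^ k‖) :
    (∀ k, ‖coeff k (iwasawaOToPowerSeries S F)‖ ≤ ‖coeff d (iwasawaOToPowerSeries S F)‖) ∧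
      ∀ k < d, ‖coeff k (iwasawaOToPowerSeries S F)‖ < ‖coeff d (iwasawaOToPowerSeries S F)‖ := by
  sorry

end Engine

/-! ### H2. The `𝒪`-valued plus Coleman value (node N1 ⊗ 𝒪; the ONE `⊗𝒪` lemma the seam needs) -/

section PlusValueO

open Polynomial Finset

variable {p : ℕ} [Fact p.Prime] (S : Set (PadicAlgCl p))

/-- **H2 (signature). Every `𝒪`-valued orbit family with the trace relation has a plus value `L ∈ 𝒪⟦T⟧`:**
`ω_{2m} ∣ Q_{2m}(a_{2m}) − (−1)^m·ω̃⁻_{2m}·L` for all `m` — the statement of the landed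
`SignedColemanImage.exists_plusValue_orbitSum` (`R = ℤ_p`) with `ℤ_p` replaced by `𝒪 = padicCoeffIntegers S`,
`𝒪` the valuation ring of a FINITE extension of `ℚ_p` (the gluing `L = lim` needs `(p,T)`-adic completeness: false for a
non-complete `𝒪`).  Route: `𝒪` is free of finite rank over `ℤ_p`; write `a = ∑_i a_i e_i` on a `ℤ_p`-basis, apply the `ℤ_p`
theorem to each `a_i` (`ω̃⁻`-divisibility is already ring-general: `SignedColemanImage.cyclotomicOmegaMinus_dvd_orbitSum`), and
sum.  For `a n j = z(gʲ • d_n)`, `z : E(ℚ_{2,∞}·ℚ_v) →+ 𝒪` the Θ-transport of `loc₂` of Kato's class of `g`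
(`T_g|_{G_{ℚ₂}} ≅ T₂W ⊗ 𝒪`, integral Schur), `L` is `Col⁺_g(loc₂ z_g)`.
[cite: Kobayashi2003, Cor. 8.20, Prop. 8.21, Def. 8.22 (pp. 21–22)] [cite: Lang1990, Ch. 5 §1 Thm. 1.1] -/
theorem exists_plusValue_orbitSum_coeff [FiniteDimensional ℚ_[p] (padicCoeffField S)]
    (a : ℕ → ℕ → padicCoeffIntegers S)
    (hper : ∀ n t, a n (t + p ^ n) = a n t)
    (htr : ∀ n r, ∑ s ∈ range p, a (n + 2) (r + p ^ (n + 1) * s) = -a n r) :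
    ∃ L : IwasawaAlgebraO S, ∀ m : ℕ,
      (((cyclotomicOmega p (2 * m)).map (Int.castRingHom (padicCoeffIntegers S)) : (padicCoeffIntegers S)[X]) :
          IwasawaAlgebraO S) ∣
        ((∑ j ∈ range (p ^ (2 * m)), Polynomial.C (a (2 * m) j) * (Polynomial.X + 1) ^ j :
            (padicCoeffIntegers S)[X]) :
            IwasawaAlgebraO S) -
          (-1 : IwasawaAlgebraO S) ^ m *
            ((((cyclotomicOmegaMinus p (2 * m)).map (Int.castRingHom (padicCoeffIntegers S)) :
                (padicCoeffIntegers S)[X]) : IwasawaAlgebraO S) * L) := by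
  sorry

end PlusValueO

/-! ### H3–H5. Value readings at one primitive character of an even level -/

section Values

open Polynomial

variable {p : ℕ} [Fact p.Prime] (S : Set (PadicAlgCl p))

/-- **H5 (signature). Value reading of an exact `ω_n`-congruence in `𝒪⟦T⟧`.**  If `ω_n ∣ P − Q·L` in `𝒪⟦T⟧`
(`P, Q` polynomials — e.g. `P = P_{n,d_n}(z)`, `Q = (−1)^{n/2} ω̃⁻_n`, `L = Col⁺(z)` from H2), then at every `z ∈ ℂ_p`,
`‖z‖ < 1`, `(1+z)^{pⁿ} = 1`: `‖P(z)‖ = ‖Q(z)‖·‖L(z)‖`.  The `𝒪`-twin (`m = 0`, no `p^m`) of the tree's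
`ResidualThetaLayer.IsCongrModOmegaO.eval₂_eq_mul`; evaluation of bounded series on the open disc
(`PAdicPowerSeriesZeros.tsum_map_coeff_mul_mul_pow`). [cite: Pollack2003, Prop. 6.18 (proof)] -/
theorem norm_eval_eq_of_omega_dvd_sub (n : ℕ) (P Q : (padicCoeffIntegers S)[X]) (L : IwasawaAlgebraO S)
    (h : (((cyclotomicOmega p n).map (Int.castRingHom (padicCoeffIntegers S)) : (padicCoeffIntegers S)[X]) :
        IwasawaAlgebraO S) ∣ (P : IwasawaAlgebraO S) - (Q : IwasawaAlgebraO S) * L)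
    {z : ℂ_[p]} (hz : ‖z‖ < 1) (hzn : (1 + z) ^ p ^ n = 1) :
    ‖(P.map ((algebraMap (PadicAlgCl p) ℂ_[p]).comp (padicCoeffIntegers S).subtype)).eval z‖ =
      ‖(Q.map ((algebraMap (PadicAlgCl p) ℂ_[p]).comp (padicCoeffIntegers S).subtype)).eval z‖ *
        ‖∑' k, algebraMap (PadicAlgCl p) ℂ_[p] (PowerSeries.coeff k (iwasawaOToPowerSeries S L)) * z ^ k‖ := by
  sorry

/-- **H3 (signature). The trivial-zero factor is a level constant.**  For `n` even and `ζ, ζ'` PRIMITIVE `2ⁿ`-th roots of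
unity in `ℂ₂`: `‖ω̃⁻_n(ζ − 1)‖ = ‖ω̃⁻_n(ζ' − 1)‖` and `ω̃⁻_n(ζ − 1) ≠ 0` (`ω̃⁻_n = ∏_{k odd ≤ n} Φ_{2^k}(1+X)` =
`cyclotomicOmegaMinus 2 n`; `Φ_{2^k}(ζ) = ζ^{2^{k−1}} + 1` with `ζ^{2^{k−1}}` of exact order `2^{n−k+1} ≥ 4`, whose distance to
`−1` depends only on that order; no root since `n − k + 1 ≠ 1`). [cite: Pollack2003, §6.5 (display before Prop. 6.18), Lemma 6.2] -/
theorem norm_eval_cyclotomicOmegaMinus_eq {n : ℕ} (hn : Even n) {ζ ζ' : ℂ_[2]}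
    (hζ : IsPrimitiveRoot ζ (2 ^ n)) (hζ' : IsPrimitiveRoot ζ' (2 ^ n)) :
    ‖((cyclotomicOmegaMinus 2 n).map (Int.castRingHom ℂ_[2])).eval (ζ - 1)‖ =
        ‖((cyclotomicOmegaMinus 2 n).map (Int.castRingHom ℂ_[2])).eval (ζ' - 1)‖ ∧
      ((cyclotomicOmegaMinus 2 n).map (Int.castRingHom ℂ_[2])).eval (ζ - 1) ≠ 0 := by
  sorry

/-- **H6 (signature). Gauss sums of 2-power conductor have a place-independent absolute value.**  For a PRIMITIVE
Dirichlet character `χ` of conductor `2^m`, `m ≥ 2`, with values in `ℂ₂` and a primitive additive character `ψ` of `ℤ/2^m`: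
`‖τ(χ, ψ)‖ = 2^{−m/2}` (so `‖τ(χ)‖ = ‖τ(χ̄)‖ = ‖τ(χ, ψ^a)‖`, every convention invisible).  Classical: for `m ≥ 2` the Gauss sum is
`2^{m/2}` times a root of unity times (for odd `m`) a quadratic Gauss sum of norm `2^{−1/2}`; or `τ(χ)τ(χ̄) = χ(−1)2^m` plus the
Galois-conjugation invariance of `‖·‖` on the abelian field `ℚ(μ_{2^∞})` in which `τ(χ)²/…` lies.  Used at (S3)/(S4)/(S6) of the glue with
`m = n + 2`. [cite: Washington1997, Lemma 4.8 + §6 (Stickelberger factorisation)] -/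
theorem norm_gaussSum_eq_of_isPrimitive {m : ℕ} (hm : 2 ≤ m) (χ : DirichletCharacter ℂ_[2] (2 ^ m))
    (hχ : χ.IsPrimitive) {ψ : AddChar (ZMod (2 ^ m)) ℂ_[2]} (hψ : ψ.IsPrimitive) :
    ‖gaussSum χ ψ‖ = (2 : ℝ) ^ (-(m : ℝ) / 2) := by
  sorry

variable {N : ℕ} (g : CuspForm (CongruenceSubgroup.Gamma0 N) 2) (ι : coeffField g →+* PadicAlgCl p) (Ω : ℂ)

/-- **H4 (signature). Pollack's even-level congruence, read in norm at a primitive character.**  For an `𝒪`-Pollack pair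
`IsPollackPairK g ι Ω L⁺ L⁻` and an EVEN `n`, at every `z = ζ − 1` with `ζ^{pⁿ} = 1`, `‖z‖ < 1`:
`‖θ_n(g;Ω)^ι(ζ − 1)‖ = ‖ω̃⁻_n(ζ − 1)‖·‖L⁻(ζ − 1)‖` — the tree's `ResidualThetaLayer.IsCongrModOmegaO.eval₂_eq_mul` applied to the
even clause of `IsPollackPairK` (`θ ≡ (−1)^{n/2+1} ω̃⁻_n L⁻ mod ω_n` in `𝒪⟦T⟧ ⊗ ℚ`), the sign killed by `‖·‖`.  Routine.
[cite: Pollack2003, Prop. 6.18] -/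
theorem norm_eval_mazurTateElementK_eq_of_isPollackPairK {Lp Lm : IwasawaAlgebraO (Set.range ι)}
    (hP : IsPollackPairK g ι Ω Lp Lm) {n : ℕ} (hn : Even n) {z : ℂ_[p]} (hz : ‖z‖ < 1) (hzn : (1 + z) ^ p ^ n = 1) :
    ‖((mazurTateElementK g Ω p n).map ι).eval₂ (algebraMap (PadicAlgCl p) ℂ_[p]) z‖ =
      ‖((cyclotomicOmegaMinus p n).map (Int.castRingHom ℂ_[p])).eval z‖ *
        ‖∑' k, algebraMap (PadicAlgCl p) ℂ_[p] (PowerSeries.coeff k (iwasawaOToPowerSeries (Set.range ι) Lm)) *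
          z ^ k‖ := by
  sorry

end Values

/-! ### GLUE. The seam: six norm identities at one primitive character per even level ⟹ `normλ(Col⁺_g(loc₂ z_g)) = d` -/

section Seam

variable {p : ℕ} [Fact p.Prime] (S : Set (PadicAlgCl p))

/-- **GLUE (proved from H1′). The trace-form seam in norm currency.**  `F = Col⁺_g(loc₂ z_g)` (H2), `G = L⁻` with norm-λ
index `d`; level-free positive constants `κ` (Kato's normalisation × de Rham transport constant `c_Θ` × `[ℚ₂(μ_{2^{n+2}}):ℚ_{2,n}]
= 2` × the denominator `2^k` making `z_g` integral), `u` (Honda: `‖3(1+ψ(−1))‖ = ‖6‖ = 1/2`), `w` (period ratio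
`‖ι(Ω_γ/Ω)‖`, `Ω_γ` Kato's, `Ω` Shimura's).  Per level `n` (even, in an infinite set), with ONE primitive even character `χ`
of conductor `2^{n+2}`, `ζ = χ(γ)`, `ζ' ∈ {ζ, ζ⁻¹}`, and reals
`A = ‖χ(P_{n,d_n}(z))‖`, `Θv = ‖θ_n(g)^ι(ζ'−1)‖`, `𝔊 = ‖∑_σ χ(σ)σ(log_Ŵ d_n)‖`, `τ = ‖τ(χ)‖ = ‖τ(χ̄)‖`, `Y = ‖(ι⊗e)(y_χ)‖`
(Kato's value datum), `ω = ‖ω̃⁻_n(ζ−1)‖`, `ω' = ‖ω̃⁻_n(ζ'−1)‖`: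
(S1) `‖F(ζ−1)‖·ω = A` [H2 + H5];  (S2) `A = κ·𝔊·Y` [KZ⁺_g-χ ∘ trace form: PRINT Kato Thm. 12.5 (1) for `g` through Θ +
tree `…PairingSumTraceForm`];  (S3) `𝔊 = u·τ` [tree `SignedEC.PlusLayer.sum_mul_ptLogΩ_smul_plusHondaPoint_eq`, W-side, BY NAME];
(S4) `Θv = τ·w·Y` [tree `ResidualThetaLayer.eval₂_map_mazurTateElementK_eq_sum` + MTT (8.6) for `g` + period ratio in `K_gˣ`];
(S5) `Θv = ω'·‖G(ζ'−1)‖` [H4];  (S6) `ω = ω' > 0`, `τ > 0` [H3; `τ(χ)τ(χ̄) = ±2^{n+2}`].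
THEN `‖F(ζ−1)‖ = (κu/w)·‖G(ζ'−1)‖` at every such level, and H1′ gives `normλ(F) = d`.  The level-DEPENDENT quantities
`τ = 2^{−(n+2)/2}` and `ω` occur on both sides and cancel; nothing is asked of `μ`, of units of `𝒪⟦T⟧`, or of all `χ`.
[cite: Kobayashi2003, Prop. 8.25–8.26, Thm. 6.3 (proof)] [cite: Kato2004Asterisque, Thm. 12.5 (1)] [cite: Pollack2003, Prop. 6.18] -/
theorem normLambda_of_seam [FiniteDimensional ℚ_[p] (padicCoeffField S)]
    (F G : IwasawaAlgebraO S) (d : ℕ)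
    (hle : ∀ k, ‖coeff k (iwasawaOToPowerSeries S G)‖ ≤ ‖coeff d (iwasawaOToPowerSeries S G)‖)
    (hlt : ∀ k < d, ‖coeff k (iwasawaOToPowerSeries S G)‖ < ‖coeff d (iwasawaOToPowerSeries S G)‖)
    {κ u w : ℝ} (hκ : 0 < κ) (hu : 0 < u) (hw : 0 < w)
    (h : ∀ n₀ : ℕ, ∃ n, n₀ ≤ n ∧ ∃ (ζ ζ' : ℂ_[p]) (A Θv 𝔊 τ Y ω ω' : ℝ),
      IsPrimitiveRoot ζ (p ^ n) ∧ IsPrimitiveRoot ζ' (p ^ n) ∧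
      -- (S1) value reading of the plus Coleman value `F` at `ζ − 1`
      ‖∑' k, algebraMap (PadicAlgCl p) ℂ_[p] (coeff k (iwasawaOToPowerSeries S F)) * (ζ - 1) ^ k‖ * ω = A ∧
      -- (S2) KZ⁺_g-χ ∘ trace form;  (S3) Honda log Gauss sum;  (S4) Birch-K + period ratio
      A = κ * 𝔊 * Y ∧ 𝔊 = u * τ ∧ Θv = τ * w * Y ∧
      -- (S5) Pollack's congruence at `ζ' − 1`
      Θv = ω' * ‖∑' k, algebraMap (PadicAlgCl p) ℂ_[p] (coeff k (iwasawaOToPowerSeries S G)) * (ζ' - 1) ^ k‖ ∧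
      -- (S6) the trivial-zero factor and the Gauss sum are level constants
      ω = ω' ∧ 0 < ω ∧ 0 < τ) :
    (∀ k, ‖coeff k (iwasawaOToPowerSeries S F)‖ ≤ ‖coeff d (iwasawaOToPowerSeries S F)‖) ∧
      ∀ k < d, ‖coeff k (iwasawaOToPowerSeries S F)‖ < ‖coeff d (iwasawaOToPowerSeries S F)‖ := by
  refine normLambda_of_norm_eval_primitiveRoots S F G d hle hlt (c := κ * u / w) (by positivity) ?_
  intro n₀
  obtain ⟨n, hn, ζ, ζ', A, Θv, 𝔊, τ, Y, ω, ω', hζ, hζ', hS1, hS2, hS3, hS4, hS5, hS6, hω, hτ⟩ := h n₀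
  refine ⟨n, hn, ζ, ζ', hζ, hζ', ?_⟩
  -- abbreviate the two values
  set VF : ℝ := ‖∑' k, algebraMap (PadicAlgCl p) ℂ_[p] (coeff k (iwasawaOToPowerSeries S F)) * (ζ - 1) ^ k‖
    with hVF
  set VG : ℝ := ‖∑' k, algebraMap (PadicAlgCl p) ℂ_[p] (coeff k (iwasawaOToPowerSeries S G)) * (ζ' - 1) ^ k‖
    with hVG
  subst hS6
  -- `VF·ω = κ·u·τ·Y` and `ω·VG = τ·w·Y`
  have e1 : VF * ω = κ * (u * τ) * Y := by rw [hS1, hS2, hS3]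
  have e2 : τ * w * Y = ω * VG := by rw [← hS4, hS5]
  -- eliminate `Y` and cancel `ω ≠ 0`
  have e3 : VF * w * ω = κ * u * VG * ω := by linear_combination w * e1 + κ * u * e2
  have e4 : VF * w = κ * u * VG := mul_right_cancel₀ hω.ne' e3
  rw [div_mul_eq_mul_div, eq_div_iff hw.ne']
  linarith [e4]

end Seam

end Summit.BirchSwinnertonDyer.BirchSwinnertonDyer.Cruxes.ResidualThetaCountLowerPureAtTwo.StubIdeasK3G3

end
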